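import Literature.NumberTheory.EllipticCurves.IwasawaAlgebra
import Literature.NumberTheory.EllipticCurves.ZpExtension
import HarnessLib

-- provenance: harness21/H21/H21/Statements/BSD/Iwasawa.lean @ 1413eaa (interim HEAD d8f2665); M5 mechanical rewrite
/-!
# BSD family: the Iwasawa-theoretic definitional package (**bsd.S22**)

Trunk `EllArithM` (group G16), statement file `H21/Statements/BSD/Iwasawa.lean`; inventory id
**bsd.S22** (role: definition): "Iwasawa algebra `Λ`, f.g. torsion `Λ`-modules, characteristic
ideal, `μ` and `λ` invariants; cyclotomic and anticyclotomic `ℤ_p`-extensions".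

All objects come from the accepted prelude files
`Literature.Prelude.EllArithM.IwasawaAlgebra` (`Literature.IwasawaAlgebra p = PowerSeries ℤ_[p]`,
`Literature.NumberTheory.EllipticCurves.Module.charIdeal`, `Literature.NumberTheory.EllipticCurves.Module.ArePseudoIsomorphic`, `Literature.NumberTheory.EllipticCurves.muInvariant`, `Literature.NumberTheory.EllipticCurves.lambdaInvariant`,
`Literature.NumberTheory.EllipticCurves.elementaryModule`, `Literature.NumberTheory.EllipticCurves.exists_isPseudoIsomorphism_elementary`, `Literature.NumberTheory.EllipticCurves.charIdeal_isPrincipal`) and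
`Literature.Prelude.EllArithM.ZpExtension` (`Literature.ZpExtension K p`, `.IsCyclotomic` — defined through the
accepted G09 cyclotomic character `Literature.NumberTheory.GaloisRepresentations.GaloisRep.cyclotomicCharacter` —, `.IsAnticyclotomic`,
`.unitTwist`, `.layer`, `.kerSubgroup`).  This file restates them under the inventory tag, each
declaration carrying **bsd.S22**:

* `iwasawaAlgebra_def`, `isNoetherianRing_iwasawaAlgebra`, `structure_theorem`,
  `charIdeal_isPrincipal'`, `mu_lambda_wellDefined` (the `Λ`-module side; Washington §13.2);
* `exists_cyclotomicZpExtension`, `cyclotomicZpExtension_unique_up_to_unit`, `finrank_layer'`,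
  `exists_anticyclotomic`, `zpRank_imaginaryQuadratic` (the `ℤ_p`-extension side; Washington §13.1,
  Thm. 13.4; Greenberg LNM 1716 §1).

## Mathlib reuse

`PowerSeries`, `PadicInt`, `IsNoetherianRing (PowerSeries _)` (instance), distinguished polynomials
as `Polynomial.IsDistinguishedAt f (IsLocalRing.maximalIdeal ℤ_[p])`
(`Mathlib/RingTheory/Polynomial/Eisenstein/Distinguished.lean`), `Module.IsTorsion`, `Module.Finite`,
`Module.finrank`, `NumberField`, `NumberField.InfinitePlace.IsComplex`, `PerfectField.ofCharZero`
(number fields are perfect, so the prelude's `[PerfectField K]` layer statements apply).  Mathlib has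
no Iwasawa algebra invariants nor `ℤ_p`-extensions (grep `Iwasawa`, `Zp.*xtension`: nothing).

## Design choices

* `noncomputable section`, `namespace Literature.BSD` (nothing needs `open scoped Classical`, so it is
  omitted, as in the prelude); all number-field statements are over an explicit `K : Type u`
  (as in the prelude `ZpExtension` file); `cyclotomicZpExtension_unique_up_to_unit` needs only
  `[Field K]`.  Declaration names follow the architect's outline (`structure_theorem`,
  `mu_lambda_wellDefined`, primed restatements) so that the planned-declaration list matches.
* `exists_cyclotomicZpExtension` is unconditional over a number field; it would follow from the
  prelude `ZpExtension.exists_isCyclotomic` plus the (not yet stated, G09/EllArithM prelude)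
  lemma that the `p`-adic cyclotomic character of a number field has infinite image.
* `mu_lambda_wellDefined` is stated for finitely generated torsion `Λ`-modules `M`, `N` (the only case
  in which `∼` is an equivalence relation and `μ`, `λ` are the structure-theorem invariants;
  Washington §13.2).
* "Exactly `ℤ_p²` of independent `ℤ_p`-extensions" of an imaginary quadratic field
  (`zpRank_imaginaryQuadratic`) is phrased choice-free: there are `κ₁ κ₂ : ZpExtension K p` with
  `(κ₁, κ₂) : Γ_K → ℤ_p × ℤ_p` surjective (independence) and
  `κ₁.kerSubgroup ⊓ κ₂.kerSubgroup ≤ κ.kerSubgroup` for every `ℤ_p`-extension `κ` (every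
  `ℤ_p`-extension lies in the compositum `K̃_∞ = K_∞^{(1)} K_∞^{(2)}`, so the `ℤ_p`-rank is exactly `2`).

Sources: K. Iwasawa, *On Γ-extensions of algebraic number fields*, Bull. AMS 65 (1959);
L. Washington, *Introduction to Cyclotomic Fields*, GTM 83, §§13.1–13.2 (Thm. 13.4, Lemma 13.5,
Thm. 13.12); B. Mazur, *Rational points of abelian varieties with values in towers of number
fields*, Invent. Math. 18 (1972); R. Greenberg, *Iwasawa theory for elliptic curves*, LNM 1716
(1999), §1.
-/

noncomputable section

open scoped Polynomial

universe u

namespace Literature.NumberTheory.EllipticCurves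

/-! ## The Iwasawa algebra and invariants of `Λ`-modules -/

section IwasawaAlgebra

variable (p : ℕ) [Fact p.Prime]

/-- **bsd.S22** (Iwasawa algebra; Iwasawa, Bull. AMS 65 (1959); Washington, *Cyclotomic Fields*,
§13.1–13.2).  The Iwasawa algebra is `Λ = ℤ_[p]⟦T⟧`, the one-variable power series ring over the
`p`-adic integers (identified with `ℤ_p⟦Γ⟧` via `γ ↦ 1 + T`). [folklore] -/
theorem iwasawaAlgebra_def : IwasawaAlgebra p = PowerSeries ℤ_[p] := rfl

/-- **bsd.S22** (Washington, *Cyclotomic Fields*, §13.1).  `Λ = ℤ_[p]⟦T⟧` is a Noetherian ring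
(Mathlib instance for power series over a Noetherian ring). [folklore] -/
theorem isNoetherianRing_iwasawaAlgebra : IsNoetherianRing (IwasawaAlgebra p) := inferInstance

variable (M : Type*) [AddCommGroup M] [Module (IwasawaAlgebra p) M]

/-- **bsd.S22** (structure theorem for finitely generated torsion `Λ`-modules; Iwasawa, Serre;
Washington, *Cyclotomic Fields*, Thm. 13.12; Mazur, Invent. Math. 18 (1972), §1).  A finitely
generated torsion `Λ`-module `M` is pseudo-isomorphic to an elementary module
`⨁ᵢ Λ/(p^{μᵢ}) ⊕ ⨁ⱼ Λ/(fⱼ^{nⱼ})` with `μᵢ, nⱼ ≥ 1` and `fⱼ ∈ ℤ_p[T]` distinguished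
(`Polynomial.IsDistinguishedAt`) and irreducible.  Restates
`Literature.NumberTheory.EllipticCurves.exists_isPseudoIsomorphism_elementary`. [folklore] -/
def structure_theorem : Prop :=
  ∀ [Module.Finite (IwasawaAlgebra p) M] (hM : Module.IsTorsion (IwasawaAlgebra p) M),
    ∃ (μs : List ℕ) (fs : List (ℤ_[p][X] × ℕ)),
      (∀ μ ∈ μs, 0 < μ) ∧
      (∀ f ∈ fs, f.1.IsDistinguishedAt (IsLocalRing.maximalIdeal ℤ_[p]) ∧
        Irreducible f.1 ∧ 0 < f.2) ∧
      Module.ArePseudoIsomorphic (IwasawaAlgebra p) M (elementaryModule p μs fs)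

/- interim proof relied on results that are now named facts (D-0014); demoted to a fact by the M5 import, proof preserved:
:=
  exists_isPseudoIsomorphism_elementary p M hM
-/

/-- **bsd.S22** (characteristic ideal; Washington, *Cyclotomic Fields*, §13.2; Mazur, Invent.
Math. 18 (1972)).  The characteristic ideal `char(M) = ∏_{ht 𝔭 = 1} 𝔭^{length M_𝔭}` of a
`Λ`-module is principal (generated by the characteristic power series `p^μ ∏ fⱼ^{nⱼ}` for f.g.
torsion `M`).  Restates `Literature.NumberTheory.EllipticCurves.charIdeal_isPrincipal`. [folklore] -/
def charIdeal_isPrincipal' : Prop :=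
  (Module.charIdeal (IwasawaAlgebra p) M).IsPrincipal

/- interim proof relied on results that are now named facts (D-0014); demoted to a fact by the M5 import, proof preserved:
:=
  charIdeal_isPrincipal p M
-/

/-- **bsd.S22** (well-definedness of the `μ`- and `λ`-invariants; Washington, *Cyclotomic Fields*,
§13.2, discussion after Thm. 13.12).  Pseudo-isomorphic finitely generated torsion `Λ`-modules
have the same `μ`-invariant and the same `λ`-invariant; hence `μ(M) = ∑ μᵢ` and
`λ(M) = ∑ nⱼ deg fⱼ` do not depend on the elementary module chosen in the structure theorem. [cite: Washington1997, §13.2 (discussion after Thm. 13.12)] -/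
def mu_lambda_wellDefined : Prop :=
  ∀ {N : Type*} [AddCommGroup N] [Module (IwasawaAlgebra p) N] [Module.Finite (IwasawaAlgebra p) M] [Module.Finite (IwasawaAlgebra p) N] (hM : Module.IsTorsion (IwasawaAlgebra p) M) (hN : Module.IsTorsion (IwasawaAlgebra p) N) (h : Module.ArePseudoIsomorphic (IwasawaAlgebra p) M N),
    muInvariant p M = muInvariant p N ∧ lambdaInvariant p M = lambdaInvariant p N

end IwasawaAlgebra

/-! ## `ℤ_p`-extensions of number fields -/

section ZpExtension


variable (K : Type u) [Field K] (p : ℕ) [Fact p.Prime]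

/-- **bsd.S22** (uniqueness of the cyclotomic `ℤ_p`-extension up to `ℤ_pˣ`; Washington,
*Cyclotomic Fields*, §13.1).  Two cyclotomic `ℤ_p`-extensions `κ, κ' : Γ_K →ₜ* ℤ_p` of `K` differ
by multiplication by a `p`-adic unit; in particular they have the same tower of fields
`K ⊆ K_1 ⊆ ⋯ ⊆ K_∞`.  Restates `Literature.NumberTheory.EllipticCurves.ZpExtension.IsCyclotomic.exists_eq_unitTwist`. [folklore] -/
def cyclotomicZpExtension_unique_up_to_unit : Prop :=
  ∀ {κ κ' : ZpExtension K p} (h : κ.IsCyclotomic) (h' : κ'.IsCyclotomic),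
    ∃ u : ℤ_[p]ˣ, κ' = κ.unitTwist u

/- interim proof relied on results that are now named facts (D-0014); demoted to a fact by the M5 import, proof preserved:
:=
  h.exists_eq_unitTwist h'
-/

variable [NumberField K]

/-- **bsd.S22** (existence of the cyclotomic `ℤ_p`-extension; Iwasawa, Bull. AMS 65 (1959);
Washington, *Cyclotomic Fields*, §13.1, p. 264).  Every number field `K` has a cyclotomic
`ℤ_p`-extension `K_∞^{cyc} ⊆ K(μ_{p^∞})`: the image of the `p`-adic cyclotomic character
`χ_p : Γ_K → ℤ_pˣ` is open, and `χ_p(Γ_K)/μ ≃ ℤ_p`.  (Reduces to the prelude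
`Literature.NumberTheory.EllipticCurves.ZpExtension.exists_isCyclotomic` once the infinitude of the image of
`Literature.GaloisRep.cyclotomicCharacter K p` for number fields is available; that lemma is the
content of this `sorry`.) [cite: Washington1997, §13.1 (p. 264)] -/
def exists_cyclotomicZpExtension : Prop :=
  ∃ κ : ZpExtension K p, κ.IsCyclotomic

-- Binder repair (2026-08-16): the header instance deliberately shadows the section's, which a
-- `def` does not capture (it ranged too widely before); the overlapping-instances linter is moot.
set_option linter.overlappingInstances false in
/-- **bsd.S22** (degrees of the layers; Washington, *Cyclotomic Fields*, §13.1).  The `n`-th layer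
`K_n` of a `ℤ_p`-extension of a number field `K` has degree `[K_n : K] = p^n`.  Restates
`Literature.NumberTheory.EllipticCurves.ZpExtension.finrank_layer` (number fields are perfect, `PerfectField.ofCharZero`). [folklore]
(Binder repair 2026-08-16: `[NumberField K]` is written in the header so that it is a parameter of
the elaborated constant; as a section instance unused by the body it was silently dropped, so the
fact ranged over cases the printed theorem excludes.) -/
def finrank_layer' [NumberField K] : Prop :=
  ∀ (κ : ZpExtension K p) (n : ℕ),
    Module.finrank K (κ.layer n) = p ^ n

/- interim proof relied on results that are now named facts (D-0014); demoted to a fact by the M5 import, proof preserved: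
:=
  κ.finrank_layer n
-/

/-- **bsd.S22** (anticyclotomic `ℤ_p`-extension; Greenberg, LNM 1716 (1999), §1; Mazur, Invent.
Math. 18 (1972); Washington, *Cyclotomic Fields*, Thm. 13.4).  An imaginary quadratic field `K`
(`[K : ℚ] = 2`, all infinite places complex) has an anticyclotomic `ℤ_p`-extension: one on whose
Galois group `≃ ℤ_p` complex conjugation acts by `-1`.  Restates
`Literature.NumberTheory.EllipticCurves.ZpExtension.exists_isAnticyclotomic`. [folklore] -/
def exists_anticyclotomic : Prop :=
  ∀ (hK : Module.finrank ℚ K = 2) (him : ∀ w : NumberField.InfinitePlace K, w.IsComplex),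
    ∃ κ : ZpExtension K p, κ.IsAnticyclotomic

/- interim proof relied on results that are now named facts (D-0014); demoted to a fact by the M5 import, proof preserved:
:=
  exists_isAnticyclotomic hK him
-/

/-- **bsd.S22** (`ℤ_p`-rank of an imaginary quadratic field; Washington, *Cyclotomic Fields*,
Thm. 13.4 with `r₂ = 1` and Leopoldt's conjecture, which holds for abelian `K/ℚ` by Brumer's
theorem; Greenberg, LNM 1716 §1).  An imaginary quadratic field `K` has exactly `ℤ_p²` worth of
independent `ℤ_p`-extensions: there are `ℤ_p`-extensions `κ₁, κ₂` with
`(κ₁, κ₂) : Γ_K → ℤ_p × ℤ_p` surjective (so `Gal(K_∞^{(1)} K_∞^{(2)}/K) ≃ ℤ_p²`), and every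
`ℤ_p`-extension of `K` is contained in their compositum
(`ker κ₁ ⊓ ker κ₂ ≤ ker κ`). [cite: Washington1997, Thm. 13.4 (with Brumer for Leopoldt)] [cite: GreenbergLNM1716, §1] -/
def zpRank_imaginaryQuadratic : Prop :=
  ∀ (hK : Module.finrank ℚ K = 2) (him : ∀ w : NumberField.InfinitePlace K, w.IsComplex),
    ∃ κ₁ κ₂ : ZpExtension K p,
      Function.Surjective (fun σ : Field.absoluteGaloisGroup K => (κ₁ σ, κ₂ σ)) ∧
      ∀ κ : ZpExtension K p, κ₁.kerSubgroup ⊓ κ₂.kerSubgroup ≤ κ.kerSubgroup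

end ZpExtension

end Literature.NumberTheory.EllipticCurves
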